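import Literature.NumberTheory.Sieve.RoughOmegaCells
import Literature.NumberTheory.Sieve.RoughCellDensity
import Mathlib.Analysis.SpecialFunctions.Pow.Asymptotics
import HarnessLib

/-!
# Ω-cells of the rough integers in a progression at scale `N`: preparations for the local law

Topic `Literature/NumberTheory/Sieve`. Everything here is PROVED. Tools for the local law of
`RoughOmegaCellsLocalAP.lean` (`Φ_j(V₂; q, r) − Φ_j(V₁; q, r) = ((V₂ − V₁)/φ(q)) A_j(N)/N + O(N/(log N (log log N)^B))`
for the `N^{1/u}`-rough `Ω = j` numbers in a progression segment), sub-namespace `RoughCellsLocal`: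

* `roughCellDensity_sub_le_sub` — the Alladi–Buchstab densities `I_j = roughCellDensity j` are
  `1`-Lipschitz on `[1, ∞)`: `I_j(w) − I_j(v) ≤ w − v` (`I_j' = I_{j−1}(· − 1)/(· − 1) ∈ [0, 1]`);
* `filter_cell_eq_empty_of_lt`, `filter_cellClass_subset` — trivialities on the cells;
* `eventually_mul_loglog_pow_le_log`, `eventually_rpow_le_div_log_sq` — the growth lemmas
  `K (log log N)^n ≤ log N` and `2N^{1/u} + 2 ≤ N/log² N` for large `N`;
* `abs_cell_sub_linear_le_of` — Step A of the local law as pure real arithmetic: from Alladi's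
  asymptotic at `(V, T)` and at `(N, T)` and the Lipschitz bound, the cell count `Φ_j(V)` differs from
  the linear model `V A_j(N)/N` by `O(N log log N/log² N)` (`V ∈ [N/log² N, L N]`).

## References

* K. Alladi, *The distribution of ν(n) in the sieve of Eratosthenes*, Quart. J. Math. Oxford (2) 33
  (1982), 129–148. [Alladi1982]
* G. Tenenbaum, *Introduction to analytic and probabilistic number theory*, Ch. III.6. [Tenenbaum2015]
-/

open Finset Filter Asymptotics
open scoped Topology ArithmeticFunction.Omega

noncomputable section

namespace Literature.NumberTheory.Sieve

namespace RoughCellsLocal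

/-! ### The densities are `1`-Lipschitz -/

/-- **`I_j` is `1`-Lipschitz on `[1, ∞)`** (`j ≥ 1`): `0 ≤ I_j(w) − I_j(v) ≤ w − v` for `1 ≤ v ≤ w`.
For `j = 1` both values are `1`; for `j ≥ 2`, `I_j(w) − I_j(v) = ∫_{v−1}^{w−1} I_{j−1}(t) dt/t` with
`0 ≤ I_{j−1}(t)/t ≤ 1` (`roughCellDensity_le`), after replacing `v, w < 2` by `2` (where `I_j = 0`).
[folklore] -/
theorem roughCellDensity_sub_le_sub {j : ℕ} (hj : 1 ≤ j) {v w : ℝ} (hv : 1 ≤ v) (hvw : v ≤ w) :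
    roughCellDensity j w - roughCellDensity j v ≤ w - v := by
  rcases eq_or_lt_of_le hj with rfl | hj2
  · rw [roughCellDensity_one_of_one_le hv, roughCellDensity_one_of_one_le (hv.trans hvw)]
    linarith
  · have hj2' : 2 ≤ j := hj2
    obtain ⟨k, rfl⟩ : ∃ k, j = k + 1 := ⟨j - 1, by omega⟩
    have hk : 1 ≤ k := by omega
    -- reduce to `2 ≤ v`
    suffices key : ∀ v w : ℝ, 2 ≤ v → v ≤ w →
        roughCellDensity (k + 1) w - roughCellDensity (k + 1) v ≤ w - v by
      have hk1 : (1 : ℝ) ≤ k := by exact_mod_cast hk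
      rcases le_or_gt 2 v with h2v | h2v
      · exact key v w h2v hvw
      · have hv0 : roughCellDensity (k + 1) v = 0 :=
          roughCellDensity_of_le hj2' (by push_cast; linarith)
        have h20 : roughCellDensity (k + 1) 2 = 0 :=
          roughCellDensity_of_le hj2' (by push_cast; linarith)
        rcases le_or_gt w 2 with h2w | h2w
        · have hw0 : roughCellDensity (k + 1) w = 0 :=
            roughCellDensity_of_le hj2' (by push_cast; linarith)
          rw [hv0, hw0]
          linarith
        · have h := key 2 w le_rfl h2w.le
          rw [h20] at h
          rw [hv0]
          linarith
    intro v w h2v hvw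
    have hint : ∀ a b : ℝ, 1 ≤ a → 1 ≤ b →
        IntervalIntegrable (fun t : ℝ => roughCellDensity k t / t) MeasureTheory.volume a b :=
      fun a b ha hb => intervalIntegrable_roughCellDensity_div hk ha hb
    rw [roughCellDensity_succ hk w, roughCellDensity_succ hk v,
      intervalIntegral.integral_interval_sub_left (hint 1 (w - 1) le_rfl (by linarith))
        (hint 1 (v - 1) le_rfl (by linarith))]
    have hmono : ∫ t in (v - 1)..(w - 1), roughCellDensity k t / t ≤ ∫ _ in (v - 1)..(w - 1), (1 : ℝ) := by
      refine intervalIntegral.integral_mono_on (by linarith) (hint _ _ (by linarith) (by linarith))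
        intervalIntegrable_const fun t ht => ?_
      have ht1 : 1 ≤ t := by linarith [ht.1]
      have ht0 : 0 < t := by linarith
      rw [div_le_one ht0]
      exact roughCellDensity_le hk ht1
    rw [intervalIntegral.integral_const, smul_eq_mul, mul_one] at hmono
    linarith

/-! ### Small lemmas -/

/-- Cells `Ω = i + 1` of `roughIcc T V` are empty for `V < T` (`T ≥ 1`): an element would be
`≥ T^{i+1} ≥ T > V`. [folklore] -/
theorem filter_cell_eq_empty_of_lt {T V : ℕ} (hT : 1 ≤ T) (hVT : V < T) (i : ℕ) :
    (roughIcc T V).filter (fun v => Ω v = i + 1) = ∅ :=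
  roughIcc_filter_cardFactors_eq_empty (lt_of_lt_of_le hVT (by
    calc T = T ^ 1 := (pow_one T).symm
      _ ≤ T ^ (i + 1) := Nat.pow_le_pow_right hT (by omega)))

/-- The class cell sits inside the cell. [folklore] -/
theorem filter_cellClass_subset (T V i q r : ℕ) :
    (roughIcc T V).filter (fun v => Ω v = i + 1 ∧ v ≡ r [MOD q]) ⊆
      (roughIcc T V).filter (fun v => Ω v = i + 1) :=
  Finset.monotone_filter_right _ fun _ _ h => h.1

/-- `K (log log N)^n ≤ log N` for all large `N`. [folklore] -/
theorem eventually_mul_loglog_pow_le_log (K : ℝ) (n : ℕ) :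
    ∀ᶠ N : ℕ in atTop, K * Real.log (Real.log N) ^ n ≤ Real.log N := by
  have h1 : (fun x => Real.log x ^ (n : ℝ)) =o[atTop] fun x => x ^ (1 : ℝ) :=
    isLittleO_log_rpow_rpow_atTop (n : ℝ) one_pos
  have h2 := h1.comp_tendsto (Real.tendsto_log_atTop.comp tendsto_natCast_atTop_atTop)
  have h3 := h2.bound (show (0 : ℝ) < 1 / (|K| + 1) by positivity)
  have h4 : ∀ᶠ N : ℕ in atTop, 1 ≤ Real.log (Real.log N) :=
    ((Real.tendsto_log_atTop.comp Real.tendsto_log_atTop).comp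
      tendsto_natCast_atTop_atTop).eventually_ge_atTop 1
  filter_upwards [h3, h4, eventually_ge_atTop 2] with N hN hll hN2
  simp only [Function.comp_apply, Real.rpow_natCast, Real.rpow_one] at hN
  have hlogN : 0 < Real.log N := Real.log_pos (by exact_mod_cast (by omega : 1 < N))
  rw [Real.norm_of_nonneg (by positivity), Real.norm_of_nonneg hlogN.le] at hN
  have hK : K ≤ |K| + 1 := by linarith [le_abs_self K]
  have hpow : 0 ≤ Real.log (Real.log N) ^ n := by positivity
  calc K * Real.log (Real.log N) ^ n ≤ (|K| + 1) * Real.log (Real.log N) ^ n :=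
        mul_le_mul_of_nonneg_right hK hpow
    _ ≤ (|K| + 1) * (1 / (|K| + 1) * Real.log N) := by gcongr
    _ = Real.log N := by field_simp

/-- `2 N^{1/u} + 2 ≤ N/log² N` for all large `N` (`u ≥ 2`). [folklore] -/
theorem eventually_rpow_le_div_log_sq {u : ℕ} (hu : 2 ≤ u) :
    ∀ᶠ N : ℕ in atTop, 2 * (N : ℝ) ^ ((1 : ℝ) / u) + 2 ≤ N / Real.log N ^ 2 := by
  have h1 : (fun x => Real.log x ^ (2 : ℝ)) =o[atTop] fun x => x ^ ((1 : ℝ) / 2) :=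
    isLittleO_log_rpow_rpow_atTop 2 (by norm_num)
  have h2 := (h1.comp_tendsto tendsto_natCast_atTop_atTop).bound (show (0 : ℝ) < 1 / 4 by norm_num)
  have h3 : ∀ᶠ N : ℕ in atTop, (4 : ℝ) ≤ (N : ℝ) ^ ((1 : ℝ) / u) :=
    ((tendsto_rpow_atTop (by positivity)).comp tendsto_natCast_atTop_atTop).eventually_ge_atTop 4
  filter_upwards [h2, h3, eventually_ge_atTop 3] with N hN hz hN3
  simp only [Function.comp_apply, Real.rpow_two] at hN
  have hN1 : (1 : ℝ) < N := by exact_mod_cast (by omega : 1 < N)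
  have hN0 : (0 : ℝ) < N := by linarith
  have hlog : 0 < Real.log N := Real.log_pos hN1
  rw [Real.norm_of_nonneg (by positivity), Real.norm_of_nonneg (by positivity)] at hN
  have hu0 : (0 : ℝ) < u := by exact_mod_cast (by omega : 0 < u)
  -- `N^{1/u} ≤ N^{1/2}` and `N^{1/2} · N^{1/2} = N`
  have hzle : (N : ℝ) ^ ((1 : ℝ) / u) ≤ (N : ℝ) ^ ((1 : ℝ) / 2) :=
    Real.rpow_le_rpow_of_exponent_le hN1.le (by
      rw [div_le_div_iff_of_pos_left one_pos hu0 two_pos]; exact_mod_cast hu)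
  have hsq : (N : ℝ) ^ ((1 : ℝ) / 2) * (N : ℝ) ^ ((1 : ℝ) / 2) = N := by
    rw [← Real.sqrt_eq_rpow, Real.mul_self_sqrt hN0.le]
  have hs0 : 0 < (N : ℝ) ^ ((1 : ℝ) / 2) := Real.rpow_pos_of_pos hN0 _
  rw [le_div_iff₀ (by positivity)]
  -- `(2 z + 2) log² N ≤ 4 z · (N^{1/2}/4) ≤ N`
  have h4 : 2 * (N : ℝ) ^ ((1 : ℝ) / u) + 2 ≤ 4 * (N : ℝ) ^ ((1 : ℝ) / 2) := by linarith
  calc (2 * (N : ℝ) ^ ((1 : ℝ) / u) + 2) * Real.log N ^ 2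
      ≤ (4 * (N : ℝ) ^ ((1 : ℝ) / 2)) * (1 / 4 * (N : ℝ) ^ ((1 : ℝ) / 2)) := by gcongr
    _ = (N : ℝ) ^ ((1 : ℝ) / 2) * (N : ℝ) ^ ((1 : ℝ) / 2) := by ring
    _ = N := hsq

/-! ### The local law -/

/-- Arithmetic of the constants in Step A of the local law. [folklore] -/
theorem coef_le_aux {C₁ L u r : ℝ} (hC₁ : 0 ≤ C₁) (hL : 0 ≤ L) (hr : 1 ≤ r) :
    C₁ * L * u ^ 2 + 12 * u * L * r + L * (C₁ * u ^ 2 + 1) + 1 ≤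
      (2 * C₁ * L * u ^ 2 + 12 * u * L + L + 1) * r := by
  have h0 : 0 ≤ C₁ * L * u ^ 2 := by positivity
  have h0' : 0 ≤ L * (C₁ * u ^ 2 + 1) + 1 := by positivity
  nlinarith


/-- **Step A of the local law, as real arithmetic.** From Alladi at `(V, T)` (`hE1`), at `(N, T)`
(`hA1`), the Lipschitz bound (`hFdiff`) and the elementary logarithmic inequalities, the cell count
`Φ(V)` differs from the linear model `V · A/N` by `≤ (2C₁Lu² + 12uL + L + 1) N log log N/log² N`
(here `r = log log N`, `lN = log N`, `ℓ = log T`, `lV = log V`, `Δ = 2 log log N + log L`). [folklore] -/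
theorem abs_cell_sub_linear_le_of {C₁ L u N V lN ℓ lV Y s lam A ΦV FV FN Δ r : ℝ}
    (hC₁ : 0 ≤ C₁) (hL0 : 0 ≤ L) (hu0 : 0 < u) (hN0 : 0 < N) (hV0 : 0 ≤ V) (hVL : V ≤ L * N)
    (hlogN0 : 0 < lN) (hℓ0 : 0 < ℓ) (hℓinv : 1 / ℓ ≤ u / lN) (hℓinv2 : 1 / ℓ ^ 2 ≤ u ^ 2 / lN ^ 2)
    (hlV0 : 0 < lV) (hlV_half : lN / 2 ≤ lV) (hlVN : |lV - lN| ≤ Δ) (hΔ0 : 0 ≤ Δ)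
    (hΔ3 : Δ ≤ 3 * r) (hr : 1 ≤ r) (hYN : Y ≤ N / lN ^ 2) (hs0 : 0 ≤ s) (hsY : s ≤ Y)
    (hFdiff : |FV - FN| ≤ Δ / ℓ) (hFN0 : 0 ≤ FN) (hFNu : FN ≤ u) (hlam : lam = FN / lN)
    (hE1 : |ΦV - (V * FV / lV - s)| ≤ C₁ * V / ℓ ^ 2) (hA1 : |A - N * lam| ≤ C₁ * N / ℓ ^ 2 + Y) :
    |ΦV - V * A / N| ≤ (2 * C₁ * L * u ^ 2 + 12 * u * L + L + 1) * N * r / lN ^ 2 := by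
  have hLN0 : 0 ≤ L * N := by positivity
  have hNlN2 : 0 < N / lN ^ 2 := by positivity
  -- `|1/log V − 1/log N| ≤ 2Δ/log² N`
  have hinv : |1 / lV - 1 / lN| ≤ 2 * Δ / lN ^ 2 := by
    rw [div_sub_div _ _ hlV0.ne' hlogN0.ne', one_mul, mul_one, abs_div,
      abs_of_pos (mul_pos hlV0 hlogN0), div_le_div_iff₀ (mul_pos hlV0 hlogN0) (by positivity),
      abs_sub_comm]
    calc |lV - lN| * lN ^ 2 ≤ Δ * lN ^ 2 := by gcongr
      _ = 2 * Δ * (lN / 2 * lN) := by ring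
      _ ≤ 2 * Δ * (lV * lN) := by gcongr
  -- E2: the main density comparison
  have hE2 : |FV / lV - lam| ≤ 4 * u * Δ / lN ^ 2 := by
    have e : FV / lV - lam = (FV - FN) * (1 / lV) + FN * (1 / lV - 1 / lN) := by
      rw [hlam]; ring
    rw [e]
    have h1 : |(FV - FN) * (1 / lV)| ≤ Δ / ℓ * (2 / lN) := by
      rw [abs_mul, abs_of_pos (by positivity : (0 : ℝ) < 1 / lV)]
      refine mul_le_mul hFdiff ?_ (by positivity) (by positivity)
      rw [div_le_div_iff₀ hlV0 hlogN0]; linarith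
    have h2 : |FN * (1 / lV - 1 / lN)| ≤ u * (2 * Δ / lN ^ 2) := by
      rw [abs_mul, abs_of_nonneg hFN0]
      exact mul_le_mul hFNu hinv (abs_nonneg _) hu0.le
    have h3 : Δ / ℓ * (2 / lN) ≤ 2 * u * Δ / lN ^ 2 := by
      have : Δ / ℓ = Δ * (1 / ℓ) := by ring
      rw [this]
      calc Δ * (1 / ℓ) * (2 / lN) ≤ Δ * (u / lN) * (2 / lN) := by gcongr
        _ = 2 * u * Δ / lN ^ 2 := by ring
    calc _ ≤ |(FV - FN) * (1 / lV)| + |FN * (1 / lV - 1 / lN)| := abs_add_le _ _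
      _ ≤ 2 * u * Δ / lN ^ 2 + u * (2 * Δ / lN ^ 2) := add_le_add (h1.trans h3) h2
      _ = 4 * u * Δ / lN ^ 2 := by ring
  -- the four error terms
  have hE1' : C₁ * V / ℓ ^ 2 ≤ C₁ * L * u ^ 2 * (N / lN ^ 2) := by
    calc C₁ * V / ℓ ^ 2 = C₁ * V * (1 / ℓ ^ 2) := by ring
      _ ≤ C₁ * (L * N) * (u ^ 2 / lN ^ 2) := by gcongr
      _ = C₁ * L * u ^ 2 * (N / lN ^ 2) := by ring
  have hE2' : |V * (FV / lV) - V * lam| ≤ 12 * u * L * r * (N / lN ^ 2) := by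
    rw [← mul_sub, abs_mul, abs_of_nonneg hV0]
    calc V * |FV / lV - lam| ≤ (L * N) * (4 * u * Δ / lN ^ 2) :=
          mul_le_mul hVL hE2 (abs_nonneg _) hLN0
      _ ≤ (L * N) * (4 * u * (3 * r) / lN ^ 2) := by gcongr
      _ = 12 * u * L * r * (N / lN ^ 2) := by ring
  have hE3 : |V * lam - V * A / N| ≤ L * (C₁ * u ^ 2 + 1) * (N / lN ^ 2) := by
    have e : V * lam - V * A / N = (V / N) * (N * lam - A) := by
      field_simp
    rw [e, abs_mul, abs_of_nonneg (div_nonneg hV0 hN0.le), abs_sub_comm]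
    have hVN : V / N ≤ L := by rw [div_le_iff₀ hN0]; exact hVL
    calc V / N * |A - N * lam| ≤ L * (C₁ * N / ℓ ^ 2 + Y) :=
          mul_le_mul hVN hA1 (abs_nonneg _) hL0
      _ ≤ L * (C₁ * N * (u ^ 2 / lN ^ 2) + N / lN ^ 2) := by
          refine mul_le_mul_of_nonneg_left (add_le_add ?_ hYN) hL0
          calc C₁ * N / ℓ ^ 2 = C₁ * N * (1 / ℓ ^ 2) := by ring
            _ ≤ C₁ * N * (u ^ 2 / lN ^ 2) := by gcongr
      _ = L * (C₁ * u ^ 2 + 1) * (N / lN ^ 2) := by ring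
  -- assembly
  have hsum : |ΦV - V * A / N| ≤
      (C₁ * L * u ^ 2 + 12 * u * L * r + L * (C₁ * u ^ 2 + 1) + 1) * (N / lN ^ 2) := by
    have e : ΦV - V * A / N =
        (ΦV - (V * FV / lV - s)) + (V * (FV / lV) - V * lam) + (V * lam - V * A / N) - s := by ring
    rw [e]
    have h4 : |s| ≤ 1 * (N / lN ^ 2) := by
      rw [abs_of_nonneg hs0, one_mul]; exact hsY.trans hYN
    calc _ ≤ |ΦV - (V * FV / lV - s)| + |V * (FV / lV) - V * lam| + |V * lam - V * A / N| + |s| :=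
          (abs_sub _ _).trans (add_le_add ((abs_add_le _ _).trans
            (add_le_add (abs_add_le _ _) le_rfl)) le_rfl)
      _ ≤ C₁ * L * u ^ 2 * (N / lN ^ 2) + 12 * u * L * r * (N / lN ^ 2) +
          L * (C₁ * u ^ 2 + 1) * (N / lN ^ 2) + 1 * (N / lN ^ 2) :=
          add_le_add (add_le_add (add_le_add (hE1.trans hE1') hE2') hE3) h4
      _ = _ := by ring
  refine hsum.trans ?_
  have e : (2 * C₁ * L * u ^ 2 + 12 * u * L + L + 1) * N * r / lN ^ 2 =
      ((2 * C₁ * L * u ^ 2 + 12 * u * L + L + 1) * r) * (N / lN ^ 2) := by ring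
  rw [e]
  exact mul_le_mul_of_nonneg_right (coef_le_aux hC₁ hL0 hr) hNlN2.le

end RoughCellsLocal

end Literature.NumberTheory.Sieve
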